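import Literature.RingTheory.HenselLemma.NewtonContraction
import Literature.NumberTheory.GaloisRepresentations.NearlyOrdinaryDeformationHensel
import Mathlib.LinearAlgebra.Matrix.Block
import Mathlib.LinearAlgebra.Matrix.ToLin
import Mathlib.LinearAlgebra.Matrix.ToLinearEquiv
import HarnessLib

/-!
# Conjugation systems `N ↦ ((1+N) M (1+N)⁻¹)ᵢⱼ` and their Newton–Hensel solution

Topic `Literature/NumberTheory/GaloisRepresentations`.  Linear algebra behind the rank-`n`
rigidification of ordinary deformation problems (Mazur §30 in rank `2` uses a Hensel eigenvector;
in rank `n` with pairwise distinct residual diagonal characters — Tilouine's `(Reg_v)`, Geraghty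
§3 — the flag, resp. the rigid representative, is pinned down by a square system of matrix
equations solved by the several-variable Hensel lemma of
`Literature.RingTheory.HenselLemma.NewtonContraction`).

Fix `n` and a set of positions `Q ⊆ Fin n × Fin n` (decidable predicate; `Pos Q` the subtype).
* `embed c` — the matrix with entries `c : Pos Q → A` at the positions of `Q` and `0` elsewhere;
  `conjSystem M s c q = ((1 + embed c) M_q (1 + embed c)⁻¹)_q - s_q` for a family of matrices
  `M : Pos Q → M_n(A)` and constants `s : Pos Q → A` — the system "conjugating by `1 + N` puts the
  prescribed value at position `q` of `M_q`";
* `commLin M` — its linearisation at `0`, `Δ ↦ ([embed Δ, M_q])_q`, and `commJac M` its matrix;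
  `conjSystem_sub_sub_mem` — the Newton estimate
  `c - c' ∈ I^r ⇒ Φ c - Φ c' - J (c - c') ∈ I^{r+1}` for `c, c'` with coordinates in `I`;
* `commLin_injective` — THE GAP ARGUMENT: over a field, if `Q` avoids the diagonal and every
  `M_q` is upper triangular with `(M_q)ⱼⱼ ≠ (M_q)ᵢᵢ` (`q = (i, j)`), then `commLin M` is
  injective (look at a lower position of maximal gap `i - j` in the support, else an upper
  position of minimal gap); hence `det (commJac M)` is a unit over a local ring whose residual
  family has these properties (`isUnit_det_commJac`);
* `existsUnique_conjSystem_eq_zero` — over a complete local ring, the system has exactly one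
  solution with coordinates in the maximal ideal; `conjSystem_map`, `commJac_map` — functoriality.

Everything is proved; nothing is asserted.  References: B. Mazur, *An introduction to the
deformation theory of Galois representations* (1997), §30; D. Geraghty, *Modularity lifting
theorems for ordinary Galois representations*, Math. Ann. 373 (2019), §3.
-/

noncomputable section

open Matrix IsLocalRing
open Literature.RingTheory.HenselLemma

namespace Literature.NumberTheory.GaloisRepresentations.Deformation

variable {n : ℕ} {Q : Fin n × Fin n → Prop} [DecidablePred Q]

/-- The positions of `Q`, as a finite type. [folklore] -/
abbrev Pos (Q : Fin n × Fin n → Prop) : Type := {q : Fin n × Fin n // Q q}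

section Embed

variable {A : Type*} [CommRing A]

/-- The matrix with entries `c` at the positions of `Q` and `0` elsewhere. [folklore] -/
def embed (c : Pos Q → A) : Matrix (Fin n) (Fin n) A :=
  Matrix.of fun i j => if h : Q (i, j) then c ⟨(i, j), h⟩ else 0

/-- Unfolding lemma for `embed`. [folklore] -/
theorem embed_apply (c : Pos Q → A) (i j : Fin n) :
    embed c i j = if h : Q (i, j) then c ⟨(i, j), h⟩ else 0 := rfl

/-- `embed c` at a position of `Q`. [folklore] -/
@[simp] theorem embed_apply_pos (c : Pos Q → A) (q : Pos Q) : embed c q.1.1 q.1.2 = c q := by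
  obtain ⟨⟨i, j⟩, h⟩ := q
  simp [embed_apply, h]

/-- `embed c` at a position of `Q` (unbundled form). [folklore] -/
theorem embed_apply_of_pos (c : Pos Q → A) {i j : Fin n} (h : Q (i, j)) :
    embed c i j = c ⟨(i, j), h⟩ := by
  simp [embed_apply, h]

/-- `embed c` vanishes off `Q`. [folklore] -/
theorem embed_apply_of_not (c : Pos Q → A) {i j : Fin n} (h : ¬ Q (i, j)) : embed c i j = 0 := by
  simp [embed_apply, h]

/-- `embed 0 = 0`. [folklore] -/
@[simp] theorem embed_zero : embed (0 : Pos Q → A) = 0 := by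
  ext i j; simp [embed_apply]

/-- `embed` is additive. [folklore] -/
theorem embed_add (c c' : Pos Q → A) : embed (c + c') = embed c + embed c' := by
  ext i j
  simp only [embed_apply, Matrix.add_apply, Pi.add_apply]
  split_ifs <;> simp

/-- `embed` is compatible with subtraction. [folklore] -/
theorem embed_sub (c c' : Pos Q → A) : embed (c - c') = embed c - embed c' := by
  ext i j
  simp only [embed_apply, Matrix.sub_apply, Pi.sub_apply]
  split_ifs <;> simp

/-- `embed` is homogeneous. [folklore] -/
theorem embed_smul (a : A) (c : Pos Q → A) : embed (a • c) = a • embed c := by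
  ext i j
  simp only [embed_apply, Matrix.smul_apply, Pi.smul_apply, smul_eq_mul]
  split_ifs <;> simp

/-- `embed` commutes with ring homomorphisms. [folklore] -/
theorem embed_map {B : Type*} [CommRing B] (f : A →+* B) (c : Pos Q → A) :
    (embed c).map f = embed (f ∘ c) := by
  ext i j
  simp only [Matrix.map_apply, embed_apply, Function.comp_apply]
  split_ifs <;> simp

/-- `embed c` has entries in `I` when `c` has coordinates in `I`. [folklore] -/
theorem embed_mem_matrix {I : Ideal A} {c : Pos Q → A} (hc : ∀ q, c q ∈ I) :
    embed c ∈ I.matrix (Fin n) := by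
  rw [Ideal.mem_matrix]
  intro i j
  rw [embed_apply]
  split_ifs with h
  · exact hc _
  · exact I.zero_mem

/-! ### The linearisation `Δ ↦ ([embed Δ, M_q])_q` -/

/-- The linearisation at `N = 0` of `N ↦ ((1+N) M_q (1+N)⁻¹)_q`: the linear map
`Δ ↦ (q ↦ (embed Δ · M_q - M_q · embed Δ)_q)`. [folklore] -/
def commLin (M : Pos Q → Matrix (Fin n) (Fin n) A) : (Pos Q → A) →ₗ[A] (Pos Q → A) where
  toFun Δ q := (embed Δ * M q - M q * embed Δ) q.1.1 q.1.2
  map_add' Δ Δ' := by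
    funext q
    simp only [embed_add, Matrix.add_mul, Matrix.mul_add, Pi.add_apply, Matrix.sub_apply,
      Matrix.add_apply]
    ring
  map_smul' a Δ := by
    funext q
    simp only [embed_smul, Matrix.smul_mul, Matrix.mul_smul, Pi.smul_apply, Matrix.sub_apply,
      Matrix.smul_apply, smul_eq_mul, RingHom.id_apply]
    ring

/-- Unfolding lemma for `commLin`. [folklore] -/
@[simp] theorem commLin_apply (M : Pos Q → Matrix (Fin n) (Fin n) A) (Δ : Pos Q → A) (q : Pos Q) :
    commLin M Δ q = (embed Δ * M q - M q * embed Δ) q.1.1 q.1.2 := rfl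

/-- The **Jacobian matrix** of the conjugation system at `0`: the matrix of `commLin M`.
[folklore] -/
def commJac (M : Pos Q → Matrix (Fin n) (Fin n) A) : Matrix (Pos Q) (Pos Q) A :=
  LinearMap.toMatrix' (commLin M)

/-- `commJac M` acts as `commLin M`. [folklore] -/
@[simp] theorem commJac_mulVec (M : Pos Q → Matrix (Fin n) (Fin n) A) (Δ : Pos Q → A) :
    commJac M *ᵥ Δ = commLin M Δ :=
  LinearMap.toMatrix'_mulVec _ _

/-- `commJac` is functorial in the coefficient ring. [folklore] -/
theorem commJac_map {B : Type*} [CommRing B] (f : A →+* B) (M : Pos Q → Matrix (Fin n) (Fin n) A) :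
    (commJac M).map f = commJac (fun q => (M q).map f) := by
  ext q q'
  have hsingle : (f : A → B) ∘ (Pi.single q' (1 : A)) = Pi.single q' (1 : B) := by
    funext x
    simp only [Function.comp_apply, Pi.single_apply]
    split_ifs <;> simp
  simp only [commJac, Matrix.map_apply, LinearMap.toMatrix'_apply, commLin_apply]
  rw [← hsingle, ← embed_map, ← Matrix.map_mul, ← Matrix.map_mul, ← Matrix.map_sub _ (map_sub f),
    Matrix.map_apply]

/-! ### The conjugation system -/

/-- **The conjugation system**: `conjSystem M s c q = ((1 + embed c) M_q (1 + embed c)⁻¹)_q - s_q`.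
Its zeros `c` with coordinates in the maximal ideal are the conjugations `1 + N`, `N` supported on
`Q` and `≡ 0`, putting the value `s_q` at position `q` of `M_q` for every `q`. [folklore] -/
def conjSystem (M : Pos Q → Matrix (Fin n) (Fin n) A) (s : Pos Q → A) (c : Pos Q → A) :
    Pos Q → A :=
  fun q => ((1 + embed c) * M q * (1 + embed c)⁻¹) q.1.1 q.1.2 - s q

/-- The conjugation system at `c = 0`. [folklore] -/
theorem conjSystem_zero (M : Pos Q → Matrix (Fin n) (Fin n) A) (s : Pos Q → A) (q : Pos Q) :
    conjSystem M s 0 q = M q q.1.1 q.1.2 - s q := by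
  simp [conjSystem]

/-- Inverting commutes with a ring homomorphism on invertible matrices. [folklore] -/
theorem map_nonsing_inv_of_isUnit {B : Type*} [CommRing B] (f : A →+* B) {m : Type*} [Fintype m]
    [DecidableEq m] {X : Matrix m m A} (hX : IsUnit X.det) : X⁻¹.map f = (X.map f)⁻¹ := by
  symm
  apply Matrix.inv_eq_left_inv
  rw [← Matrix.map_mul, Matrix.nonsing_inv_mul X hX, Matrix.map_one _ (map_zero f) (map_one f)]

/-- The conjugation system is functorial in the coefficient ring (on the locus where `1 + embed c`
is invertible). [folklore] -/
theorem conjSystem_map {B : Type*} [CommRing B] (f : A →+* B) (M : Pos Q → Matrix (Fin n) (Fin n) A)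
    (s c : Pos Q → A) (hc : IsUnit (1 + embed c).det) :
    f ∘ conjSystem M s c = conjSystem (fun q => (M q).map f) (f ∘ s) (f ∘ c) := by
  funext q
  simp only [Function.comp_apply, conjSystem, map_sub]
  congr 1
  rw [← Matrix.map_apply (f := f), Matrix.map_mul, Matrix.map_mul, map_nonsing_inv_of_isUnit f hc,
    Matrix.map_add _ (map_add f), embed_map, Matrix.map_one _ (map_zero f) (map_one f)]

/-- **The Newton estimate for the conjugation system**: for `c, c'` with coordinates in an ideal
`I` inside the Jacobson radical and `c - c' ∈ I^r` coordinatewise,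
`Φ c - Φ c' - J (c - c') ∈ I^{r+1}` coordinatewise, where `J = commJac M`. [folklore] -/
theorem conjSystem_sub_sub_mem {I : Ideal A} (hI : I ≤ Ideal.jacobson ⊥)
    (M : Pos Q → Matrix (Fin n) (Fin n) A) (s : Pos Q → A) (r : ℕ) (c c' : Pos Q → A)
    (hc : ∀ q, c q ∈ I) (hc' : ∀ q, c' q ∈ I) (hcc' : ∀ q, c q - c' q ∈ I ^ r) (q : Pos Q) :
    (conjSystem M s c - conjSystem M s c' - commJac M *ᵥ (c - c')) q ∈ I ^ (r + 1) := by
  set E := embed c with hE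
  set E' := embed c' with hE'
  set D := embed (c - c') with hD
  set X := 1 + E with hX
  set X' := 1 + E' with hX'
  have hEI : E ∈ I.matrix (Fin n) := embed_mem_matrix hc
  have hE'I : E' ∈ I.matrix (Fin n) := embed_mem_matrix hc'
  have hDI : D ∈ (I ^ r).matrix (Fin n) := embed_mem_matrix hcc'
  have hXu : IsUnit X.det := isUnit_det_one_add hI hEI
  have hX'u : IsUnit X'.det := isUnit_det_one_add hI hE'I
  have hXXi : X * X⁻¹ = 1 := Matrix.mul_nonsing_inv X hXu
  have hXi'X' : X'⁻¹ * X' = 1 := Matrix.nonsing_inv_mul X' hX'u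
  have hX'Xi' : X' * X'⁻¹ = 1 := Matrix.mul_nonsing_inv X' hX'u
  have hXiI : X⁻¹ - 1 ∈ I.matrix (Fin n) := inv_one_add_sub_one_mem hI hEI
  have hDXX' : D = X - X' := by
    rw [hD, hX, hX', hE, hE', embed_sub]; abel
  -- the coordinate `q` of the three vectors
  rw [Pi.sub_apply, Pi.sub_apply, commJac_mulVec, commLin_apply]
  simp only [conjSystem]
  rw [← hD]
  have hrw : ((X * M q * X⁻¹) q.1.1 q.1.2 - s q) - ((X' * M q * X'⁻¹) q.1.1 q.1.2 - s q) -
      (D * M q - M q * D) q.1.1 q.1.2 =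
      (X * M q * X⁻¹ - X' * M q * X'⁻¹ - (D * M q - M q * D)) q.1.1 q.1.2 := by
    simp only [Matrix.sub_apply]; ring
  rw [hrw]
  -- the matrix identity
  have hdiff : X⁻¹ - X'⁻¹ = -(X'⁻¹ * D * X⁻¹) := by
    rw [hDXX', Matrix.mul_sub, Matrix.sub_mul, Matrix.mul_assoc X'⁻¹ X X⁻¹, hXXi, Matrix.mul_one,
      hXi'X', Matrix.one_mul]
    abel
  have e1 : X * M q * X⁻¹ - X' * M q * X'⁻¹ = D * M q * X⁻¹ + X' * M q * (X⁻¹ - X'⁻¹) := by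
    rw [hDXX']; noncomm_ring
  have e2 : X' * M q * X'⁻¹ - M q = (E' * M q - M q * E') * X'⁻¹ := by
    calc X' * M q * X'⁻¹ - M q = X' * M q * X'⁻¹ - M q * (X' * X'⁻¹) := by rw [hX'Xi', Matrix.mul_one]
      _ = (E' * M q - M q * E') * X'⁻¹ := by rw [hX']; noncomm_ring
  have key : X * M q * X⁻¹ - X' * M q * X'⁻¹ - (D * M q - M q * D) =
      D * M q * (X⁻¹ - 1) - ((X' * M q * X'⁻¹ - M q) * D * X⁻¹ + M q * D * (X⁻¹ - 1)) := by
    rw [e1, hdiff]; noncomm_ring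
  rw [key, e2]
  -- membership
  have hpow : I ^ r * I = I ^ (r + 1) := (pow_succ I r).symm
  have hpow' : I * I ^ r = I ^ (r + 1) := (pow_succ' I r).symm
  have t1 : D * M q * (X⁻¹ - 1) ∈ (I ^ (r + 1)).matrix (Fin n) := by
    rw [← hpow]; exact matrix_mul_mem_mul (matrix_mul_mem_of_left hDI _) hXiI
  have t2 : (E' * M q - M q * E') * X'⁻¹ * D * X⁻¹ ∈ (I ^ (r + 1)).matrix (Fin n) := by
    rw [← hpow']
    refine matrix_mul_mem_of_left (matrix_mul_mem_mul (matrix_mul_mem_of_left ?_ _) hDI) _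
    exact sub_mem (matrix_mul_mem_of_left hE'I _) (matrix_mul_mem_of_right _ hE'I)
  have t3 : M q * D * (X⁻¹ - 1) ∈ (I ^ (r + 1)).matrix (Fin n) := by
    rw [← hpow]; exact matrix_mul_mem_mul (matrix_mul_mem_of_right _ hDI) hXiI
  exact (Ideal.mem_matrix _ _ _).1 (sub_mem t1 (add_mem t2 t3)) _ _

end Embed

/-! ### The gap argument: injectivity of the linearisation over a field -/

section Gap

variable {k : Type*} [Field k]

/-- The gap `|i - j|`-type invariant of a position: `i - j` (as a natural number; meaningful for
lower positions `j < i`). [folklore] -/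
def lowerGap (q : Pos Q) : ℕ := (q.1.1 : ℕ) - q.1.2

/-- The gap `j - i` of a position (meaningful for upper positions `i < j`). [folklore] -/
def upperGap (q : Pos Q) : ℕ := (q.1.2 : ℕ) - q.1.1

/-- **Lower step of the gap argument.**  Let `q₀ = (i, j)` be a lower position (`j < i`) such that
`Δ` vanishes at every lower position of larger gap, and let `M` be upper triangular.  Then
`([embed Δ, M])_{q₀} = Δ_{q₀} (M ⱼⱼ - M ᵢᵢ)`. [folklore] -/
theorem commutator_apply_of_lower {A : Type*} [CommRing A] (Δ : Pos Q → A)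
    (M : Matrix (Fin n) (Fin n) A) (hM : M.BlockTriangular id) (q₀ : Pos Q) (hq₀ : q₀.1.2 < q₀.1.1)
    (hvan : ∀ q : Pos Q, q.1.2 < q.1.1 → lowerGap q₀ < lowerGap q → Δ q = 0) :
    (embed Δ * M - M * embed Δ) q₀.1.1 q₀.1.2 = Δ q₀ * (M q₀.1.2 q₀.1.2 - M q₀.1.1 q₀.1.1) := by
  obtain ⟨⟨i, j⟩, hq⟩ := q₀
  simp only at hq₀ hvan ⊢
  rw [Matrix.sub_apply, Matrix.mul_apply, Matrix.mul_apply]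
  -- first sum: only `l = j` survives
  rw [Finset.sum_eq_single j, Finset.sum_eq_single i]
  · rw [embed_apply_of_pos Δ hq]; ring
  · intro l _ hl
    -- `M i l ≠ 0` forces `i ≤ l`; then `(l, j)` is lower of larger gap, or vanishes off `Q`
    by_cases hil : l < i
    · rw [hM hil, zero_mul]
    · have hil' : i < l := lt_of_le_of_ne (not_lt.1 hil) (Ne.symm hl)
      by_cases hQ : Q (l, j)
      · rw [embed_apply_of_pos Δ hQ, hvan ⟨(l, j), hQ⟩ (lt_trans hq₀ hil') ?_, mul_zero]
        simp only [lowerGap]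
        have h1 : (j : ℕ) < i := hq₀
        have h2 : (i : ℕ) < l := hil'
        omega
      · rw [embed_apply_of_not Δ hQ, mul_zero]
  · intro hi; exact absurd (Finset.mem_univ i) hi
  · intro l _ hl
    by_cases hlj : j < l
    · rw [hM hlj, mul_zero]
    · have hlj' : l < j := lt_of_le_of_ne (not_lt.1 hlj) hl
      by_cases hQ : Q (i, l)
      · rw [embed_apply_of_pos Δ hQ, hvan ⟨(i, l), hQ⟩ (lt_trans hlj' hq₀) ?_, zero_mul]
        simp only [lowerGap]
        have h1 : (j : ℕ) < i := hq₀
        have h2 : (l : ℕ) < j := hlj'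
        omega
      · rw [embed_apply_of_not Δ hQ, zero_mul]
  · intro hj; exact absurd (Finset.mem_univ j) hj

/-- **Upper step of the gap argument.**  Let `q₀ = (i, j)` be an upper position (`i < j`) such
that `Δ` vanishes at every lower position, at every diagonal position, and at every upper position
of smaller gap, and let `M` be upper triangular.  Then `([embed Δ, M])_{q₀} = Δ_{q₀} (Mⱼⱼ - Mᵢᵢ)`.
[folklore] -/
theorem commutator_apply_of_upper {A : Type*} [CommRing A] (Δ : Pos Q → A)
    (M : Matrix (Fin n) (Fin n) A) (hM : M.BlockTriangular id) (q₀ : Pos Q) (hq₀ : q₀.1.1 < q₀.1.2)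
    (hlow : ∀ q : Pos Q, q.1.2 < q.1.1 → Δ q = 0) (hdiag : ∀ q : Pos Q, q.1.1 = q.1.2 → Δ q = 0)
    (hvan : ∀ q : Pos Q, q.1.1 < q.1.2 → upperGap q < upperGap q₀ → Δ q = 0) :
    (embed Δ * M - M * embed Δ) q₀.1.1 q₀.1.2 = Δ q₀ * (M q₀.1.2 q₀.1.2 - M q₀.1.1 q₀.1.1) := by
  obtain ⟨⟨i, j⟩, hq⟩ := q₀
  simp only at hq₀ hvan ⊢
  -- `Δ` vanishes at every position `(a, b)` of `Q` unless `a < b` with gap `≥ j - i`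
  have hzero : ∀ (a b : Fin n) (h : Q (a, b)), ¬ (a < b ∧ upperGap (⟨(i, j), hq⟩ : Pos Q) ≤
      upperGap (⟨(a, b), h⟩ : Pos Q)) → embed Δ a b = 0 := by
    intro a b h hn
    rw [embed_apply_of_pos Δ h]
    rcases lt_trichotomy a b with hab | hab | hab
    · exact hvan ⟨(a, b), h⟩ hab (lt_of_not_ge fun hge => hn ⟨hab, hge⟩)
    · exact hdiag ⟨(a, b), h⟩ hab
    · exact hlow ⟨(a, b), h⟩ hab
  rw [Matrix.sub_apply, Matrix.mul_apply, Matrix.mul_apply]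
  rw [Finset.sum_eq_single j, Finset.sum_eq_single i]
  · rw [embed_apply_of_pos Δ hq]; ring
  · intro l _ hl
    by_cases hil : l < i
    · rw [hM hil, zero_mul]
    · have hil' : i < l := lt_of_le_of_ne (not_lt.1 hil) (Ne.symm hl)
      by_cases hQ : Q (l, j)
      · rw [hzero l j hQ ?_, mul_zero]
        rintro ⟨hlj, hge⟩
        simp only [upperGap] at hge
        have h1 : (i : ℕ) < l := hil'
        have h2 : (l : ℕ) < j := hlj
        omega
      · rw [embed_apply_of_not Δ hQ, mul_zero]
  · intro hi; exact absurd (Finset.mem_univ i) hi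
  · intro l _ hl
    by_cases hlj : j < l
    · rw [hM hlj, mul_zero]
    · have hlj' : l < j := lt_of_le_of_ne (not_lt.1 hlj) hl
      by_cases hQ : Q (i, l)
      · rw [hzero i l hQ ?_, zero_mul]
        rintro ⟨hil, hge⟩
        simp only [upperGap] at hge
        have h1 : (l : ℕ) < j := hlj'
        have h2 : (i : ℕ) < l := hil
        omega
      · rw [embed_apply_of_not Δ hQ, zero_mul]
  · intro hj; exact absurd (Finset.mem_univ j) hj

/-- **The gap argument.**  Over a field, let `Q` avoid the diagonal and let `M_q` be upper
triangular with `(M_q)ⱼⱼ ≠ (M_q)ᵢᵢ` for every `q = (i, j) ∈ Q` (pairwise distinct residual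
diagonal characters, evaluated at a separating element).  Then the linearisation `commLin M` is
injective.  (If `Δ ≠ 0` has a non-zero entry at a lower position, evaluate `([embed Δ, M_q])_q`
at such a position `q` of maximal gap; otherwise at an upper position of minimal gap: in both
cases it equals `Δ_q ((M_q)ⱼⱼ - (M_q)ᵢᵢ) ≠ 0`.) [folklore] -/
theorem commLin_injective (hQ : ∀ i : Fin n, ¬ Q (i, i)) (M : Pos Q → Matrix (Fin n) (Fin n) k)
    (hM : ∀ q, (M q).BlockTriangular id) (hne : ∀ q : Pos Q, M q q.1.2 q.1.2 ≠ M q q.1.1 q.1.1) :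
    Function.Injective (commLin M) := by
  rw [← LinearMap.ker_eq_bot, LinearMap.ker_eq_bot']
  intro Δ hΔ
  by_contra hne0
  have hΔq : ∀ q, commLin M Δ q = 0 := fun q => by rw [hΔ]; rfl
  by_cases hlow : ∃ q : Pos Q, q.1.2 < q.1.1 ∧ Δ q ≠ 0
  · -- a lower position of maximal gap in the support
    classical
    obtain ⟨q₀, hq₀mem, hq₀max⟩ := Finset.exists_max_image
      (Finset.univ.filter fun q : Pos Q => q.1.2 < q.1.1 ∧ Δ q ≠ 0) lowerGap
      (by obtain ⟨q, hq⟩ := hlow; exact ⟨q, Finset.mem_filter.2 ⟨Finset.mem_univ _, hq⟩⟩)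
    obtain ⟨hq₀low, hq₀ne⟩ := (Finset.mem_filter.1 hq₀mem).2
    have h := commutator_apply_of_lower Δ (M q₀) (hM q₀) q₀ hq₀low (fun q hq hgap => by
      by_contra hqne
      exact absurd (hq₀max q (Finset.mem_filter.2 ⟨Finset.mem_univ _, hq, hqne⟩)) (not_le.2 hgap))
    rw [← commLin_apply, hΔq q₀] at h
    exact hq₀ne ((mul_eq_zero.1 h.symm).resolve_right (sub_ne_zero.2 (hne q₀)))
  · push Not at hlow
    -- all lower entries vanish; an upper position of minimal gap in the support
    have hdiag : ∀ q : Pos Q, q.1.1 = q.1.2 → Δ q = 0 := by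
      intro q hq
      obtain ⟨⟨i, j⟩, h⟩ := q
      simp only at hq
      subst hq
      exact absurd h (hQ i)
    have hsupp : ∃ q : Pos Q, q.1.1 < q.1.2 ∧ Δ q ≠ 0 := by
      by_contra hall
      push Not at hall
      apply hne0
      funext q
      rcases lt_trichotomy q.1.1 q.1.2 with h | h | h
      · exact hall q h
      · exact hdiag q h
      · exact hlow q h
    classical
    obtain ⟨q₀, hq₀mem, hq₀min⟩ := Finset.exists_min_image
      (Finset.univ.filter fun q : Pos Q => q.1.1 < q.1.2 ∧ Δ q ≠ 0) upperGap
      (by obtain ⟨q, hq⟩ := hsupp; exact ⟨q, Finset.mem_filter.2 ⟨Finset.mem_univ _, hq⟩⟩)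
    obtain ⟨hq₀up, hq₀ne⟩ := (Finset.mem_filter.1 hq₀mem).2
    have h := commutator_apply_of_upper Δ (M q₀) (hM q₀) q₀ hq₀up hlow hdiag (fun q hq hgap => by
      by_contra hqne
      exact absurd (hq₀min q (Finset.mem_filter.2 ⟨Finset.mem_univ _, hq, hqne⟩)) (not_le.2 hgap))
    rw [← commLin_apply, hΔq q₀] at h
    exact hq₀ne ((mul_eq_zero.1 h.symm).resolve_right (sub_ne_zero.2 (hne q₀)))

/-- Under the hypotheses of the gap argument, `det (commJac M) ≠ 0`. [folklore] -/
theorem det_commJac_ne_zero (hQ : ∀ i : Fin n, ¬ Q (i, i)) (M : Pos Q → Matrix (Fin n) (Fin n) k)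
    (hM : ∀ q, (M q).BlockTriangular id) (hne : ∀ q : Pos Q, M q q.1.2 q.1.2 ≠ M q q.1.1 q.1.1) :
    (commJac M).det ≠ 0 := by
  classical
  intro hdet
  obtain ⟨v, hv, hJv⟩ := Matrix.exists_mulVec_eq_zero_iff.2 hdet
  rw [commJac_mulVec] at hJv
  exact hv (commLin_injective hQ M hM hne (by rw [hJv, map_zero]))

end Gap

/-! ### Over a local ring: the Jacobian is invertible, and the system has a unique solution -/

section Local

variable {A : Type*} [CommRing A] [IsLocalRing A] {k : Type*} [Field k] {π : A →+* k}

/-- **The Jacobian of the conjugation system is invertible** over a local ring as soon as,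
residually, `Q` avoids the diagonal and the `M̄_q` are upper triangular with
`(M̄_q)ⱼⱼ ≠ (M̄_q)ᵢᵢ`. [folklore] -/
theorem isUnit_det_commJac (hπ : Function.Surjective π) (hQ : ∀ i : Fin n, ¬ Q (i, i))
    (M : Pos Q → Matrix (Fin n) (Fin n) A) (hM : ∀ q, ((M q).map π).BlockTriangular id)
    (hne : ∀ q : Pos Q, π (M q q.1.2 q.1.2) ≠ π (M q q.1.1 q.1.1)) :
    IsUnit (commJac M).det := by
  rw [isUnit_iff_residue_ne_zero hπ, RingHom.map_det, RingHom.mapMatrix_apply, commJac_map]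
  exact det_commJac_ne_zero hQ _ hM (fun q => by simpa only [Matrix.map_apply] using hne q)

/-- **Unique solvability of the conjugation system** over a complete local ring: if residually
`Q` avoids the diagonal, the `M̄_q` are upper triangular with `(M̄_q)ⱼⱼ ≠ (M̄_q)ᵢᵢ`, and
`s_q ≡ (M_q)_q`, then there is exactly one `c` with coordinates in the maximal ideal such that
`((1 + embed c) M_q (1 + embed c)⁻¹)_q = s_q` for all `q ∈ Q`.  (Newton–Hensel,
`existsUnique_zero_of_newton`, with the estimate `conjSystem_sub_sub_mem` and the gap argument.)
[folklore] -/
theorem existsUnique_conjSystem_eq_zero [IsAdicComplete (maximalIdeal A) A]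
    (hπ : Function.Surjective π) (hQ : ∀ i : Fin n, ¬ Q (i, i))
    (M : Pos Q → Matrix (Fin n) (Fin n) A) (s : Pos Q → A)
    (hM : ∀ q, ((M q).map π).BlockTriangular id)
    (hne : ∀ q : Pos Q, π (M q q.1.2 q.1.2) ≠ π (M q q.1.1 q.1.1))
    (hs : ∀ q : Pos Q, π (M q q.1.1 q.1.2) = π (s q)) :
    ∃! c : Pos Q → A, (∀ q, c q ∈ maximalIdeal A) ∧ conjSystem M s c = 0 := by
  classical
  have hJ : IsUnit (commJac M).det := isUnit_det_commJac hπ hQ M hM hne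
  have hjac : maximalIdeal A ≤ Ideal.jacobson ⊥ := by
    rw [IsLocalRing.jacobson_eq_maximalIdeal ⊥ bot_ne_top]
  refine existsUnique_zero_of_newton (maximalIdeal A) (conjSystem M s) (commJac M) hJ ?_ ?_
  · intro q
    rw [conjSystem_zero, mem_maximalIdeal_iff_residue_eq_zero hπ, map_sub, hs q, sub_self]
  · intro r c c' hc hc' hcc' q
    exact conjSystem_sub_sub_mem hjac M s r c c' hc hc' hcc' q

end Local

end Literature.NumberTheory.GaloisRepresentations.Deformation
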